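import Summits.QuantumFields.GaugeBoot.LinearShiftDerivatives
import Summits.QuantumFields.GaugeBoot.BootstrapFunctionals
import HarnessLib

/-!
# Left one-link loop equations imply the RIGHT one-link loop equations (gauge-boot, L1 supplement)

HONEST FRAMING (cell `pub-gaugeboot`, page 1 of every file): the venture produces certified bounds
on lattice expectations at stated coupling, gauge group, dimension and torus size; NOT a mass gap,
NOT a continuum limit, NOT a string tension; NOT Yang–Mills-summit-bearing (barriers
`FixedCouplingUltralocality`, `PerturbativeInvisibility`). Structural; it certifies no number.

## Content

The tree's bootstrap rows (`IsSDFunctional`) differentiate along the LEFT one-link shifts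
`U ↦ U[i ↦ e^{tX} U_i]`. A reflection of the lattice reverses links, and on a reversed link a left
shift becomes a RIGHT shift `U ↦ U[i ↦ U_i e^{tX}]`; Haar measure being two-sided invariant, the
Wilson state satisfies both kinds of rows, but for an abstract linear functional the right rows must
be DERIVED from the left ones. This file does so, algebraically and without positivity:

* `IsRightSDFunctional r k S β φ` — the right rows (`φ f' = β φ (f S')` with right derivatives);
* `rho_conj_family`, ★ `HasLinearShiftDeriv.hasDerivAt_rightShift` — a right shift by `e^{tX}` at
  `U` is the left shift by the conjugate family `U_i e^{tX} U_i⁻¹ = e^{t Ad(U_i)X}`, so the right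
  derivative of a polynomial observable is its LINEAR left derivative evaluated at
  `Y(U) = ρ(U_i) X ρ(U_i)⁻¹` (`adjDir`), a matrix-valued polynomial (`entriesPoly_adjDir`) with
  left derivative `[X_c, Y]` along `e^{tX_c}` (`hasDerivAt_adjDir_update`);
* ★★★ `IsSDFunctional.isRightSDFunctional` — if the generators are reproduced by finitely many
  directions `X_j` with linear coordinates `c_j`, `Y = Σ_j c_j(Y) X_j` on the `Ad`-orbits (`hrep`),
  and the coordinates are DIVERGENCE FREE, `c_j([X_j, Y]) = 0` (`hdiv` — infinitesimal
  unimodularity), then every Schwinger–Dyson functional for polynomial local actions satisfies the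
  right rows: `φ(D^R f) = Σ_j φ(c_j D_j f) = Σ_j [β φ(c_j f D_j S) - φ(f D_j c_j)] = β φ(f D^R S)`
  (Leibniz inside the polynomial algebra; the divergence term vanishes identically).

The hypotheses are discharged for `U(N)` and `SU(N)` with the matrix-unit directions
`E_ab - E_ba`, `i(E_ab + E_ba)` (traceless-corrected on the diagonal for `SU(N)`) in the sequel
`RightShiftRowsUnitary.lean`.

References: M. Creutz, *Quarks, gluons and lattices* (1983) Ch. 8 (left/right invariance of the
Haar measure); Yu. Makeenko, *Methods of contemporary gauge theory* (2002) Ch. 12. Folklore.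
-/

noncomputable section

open Filter Topology NormedSpace
open scoped Matrix.Norms.Frobenius Matrix
open Literature.MathematicalPhysics.QuantumFieldTheory (LatticeRep)

namespace Summit.QuantumFields.GaugeBoot

variable {ι : Type*} {G : Type*} [Group G] [TopologicalSpace G] (r : LatticeRep G)

/-! ## Right rows -/

section Defs

variable [DecidableEq ι] {K : Type*}

/-- **Right Schwinger–Dyson functional**: the loop equations of `IsSDFunctional` with the RIGHT
one-link shifts `U ↦ U[i ↦ U_i k_a(t)]` in place of the left ones — for every link `i` and generator
`a` the local action `S i` has a polynomial right derivative `S'` and `φ f' = β φ (f S')` for every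
polynomial `f` with polynomial right derivative `f'`. [shape] A parametric definition of a
proposition — NOT a fact. [folklore] -/
def IsRightSDFunctional (k : K → ℝ → G) (S : ι → (ι → G) → ℝ) (β : ℝ) (φ : C(ι → G, ℝ) →ₗ[ℝ] ℝ) :
    Prop :=
  ∀ (i : ι) (a : K), ∃ S' ∈ polyAlgebra (ι := ι) r,
    (∀ U, HasDerivAt (fun t => S i (Function.update U i (U i * k a t))) (S' U) 0) ∧
      ∀ f ∈ polyAlgebra (ι := ι) r, ∀ f' ∈ polyAlgebra (ι := ι) r,
        (∀ U, HasDerivAt (fun t => f (Function.update U i (U i * k a t))) (f' U) 0) →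
          φ f' = β * φ (f * S')

end Defs

/-! ## Right shifts are conjugated left shifts -/

section Conj

variable {r}

/-- **The conjugate family**: `ρ(g k(t) g⁻¹) = e^{t ρ(g) X ρ(g⁻¹)}` when `ρ(k t) = e^{tX}`
(`rho_conj_exp` at `g⁻¹`). -/
theorem rho_conj_family {k : ℝ → G} {X : Matrix (Fin r.N) (Fin r.N) ℂ}
    (hX : ∀ t, r.ρ (k t) = exp ((t : ℂ) • X)) (g : G) (t : ℝ) :
    r.ρ (g * k t * g⁻¹) = exp ((t : ℂ) • (r.ρ g * X * r.ρ g⁻¹)) := by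
  have h := rho_conj_exp hX g⁻¹ t
  rwa [inv_inv] at h

/-- ★ **The right derivative is the linear left derivative at the conjugated generator**: if `S`
has the linear left shift derivative `D` at the link `e`, then along the right shift
`U ↦ U[e ↦ U_e k(t)]`, `ρ(k t) = e^{tX}`, it has derivative `D U (ρ(U_e) X ρ(U_e⁻¹))`. [folklore] -/
theorem HasLinearShiftDeriv.hasDerivAt_rightShift [DecidableEq ι] {e : ι} {S : (ι → G) → ℝ}
    {D : (ι → G) → Matrix (Fin r.N) (Fin r.N) ℂ →ₗ[ℝ] ℝ} (hD : HasLinearShiftDeriv r e S D)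
    {k : ℝ → G} {X : Matrix (Fin r.N) (Fin r.N) ℂ} (hX : ∀ t, r.ρ (k t) = exp ((t : ℂ) • X))
    (U : ι → G) :
    HasDerivAt (fun t => S (Function.update U e (U e * k t))) (D U (r.ρ (U e) * X * r.ρ (U e)⁻¹)) 0 := by
  have h := hD.2 (fun t => U e * k t * (U e)⁻¹) (r.ρ (U e) * X * r.ρ (U e)⁻¹)
    (fun t => rho_conj_family hX (U e) t) U
  have hfun : (fun t => S (Function.update U e (U e * k t * (U e)⁻¹ * U e))) =
      fun t => S (Function.update U e (U e * k t)) := by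
    funext t
    rw [inv_mul_cancel_right]
  rwa [hfun] at h

variable (r)

/-- **The conjugated generator** `Y(U) = ρ(U_i) X ρ(U_i⁻¹) = ρ(Ad(U_i) X)` as a matrix-valued function
of the configuration. [folklore] -/
def adjDir (i : ι) (X : Matrix (Fin r.N) (Fin r.N) ℂ) (U : ι → G) : Matrix (Fin r.N) (Fin r.N) ℂ :=
  r.ρ (U i) * X * r.ρ (U i)⁻¹

/-- `adjDir` unfolded. -/
theorem adjDir_apply (i : ι) (X : Matrix (Fin r.N) (Fin r.N) ℂ) (U : ι → G) :
    adjDir r i X U = r.ρ (U i) * X * r.ρ (U i)⁻¹ := rfl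

/-- Constant functions are polynomial observables. -/
theorem const_mem_polyFunctions (c : ℝ) : (fun _ : ι → G => c) ∈ polyFunctions (ι := ι) r := by
  have h : (fun _ : ι → G => c) = algebraMap ℝ ((ι → G) → ℝ) c := by
    funext U; simp
  rw [h]
  exact Subalgebra.algebraMap_mem _ c

/-- Constant matrices have polynomial entries. -/
theorem entriesPoly_const (M : Matrix (Fin r.N) (Fin r.N) ℂ) : EntriesPoly r (fun _ : ι → G => M) := fun a b =>
  ⟨const_mem_polyFunctions r (M a b).re, const_mem_polyFunctions r (M a b).im⟩

/-- **`Y(U) = ρ(U_i) X ρ(U_i⁻¹)` has polynomial entries** (quadratic in the entries of `ρ(U_i)`,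
`ρ(U_i⁻¹) = ρ(U_i)ᴴ`). -/
theorem entriesPoly_adjDir (i : ι) (X : Matrix (Fin r.N) (Fin r.N) ℂ) : EntriesPoly r (adjDir (ι := ι) r i X) :=
  ((entriesPoly_rho r i).mul r (entriesPoly_const r X)).mul r (entriesPoly_rho_inv r i)

/-- **The left derivative of `Y` along `e^{tX_c}` at the same link is the commutator `[X_c, Y]`.** -/
theorem hasDerivAt_adjDir_update [DecidableEq ι] (i : ι) (X : Matrix (Fin r.N) (Fin r.N) ℂ) {k : ℝ → G}
    (hk : ∀ s t, k (s + t) = k s * k t) {Xc : Matrix (Fin r.N) (Fin r.N) ℂ}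
    (hXc : ∀ t, r.ρ (k t) = exp ((t : ℂ) • Xc)) (U : ι → G) :
    HasDerivAt (fun t => adjDir r i X (Function.update U i (k t * U i)))
      (Xc * adjDir r i X U - adjDir r i X U * Xc) 0 := by
  have h1 := hasDerivAt_rho_update r.ρ hXc i i U
  have h2 := hasDerivAt_rho_update_inv r.ρ hk hXc i i U
  simp only [if_true] at h1 h2
  have h := (h1.mul_const X).mul h2
  have h0 : Function.update U i (k 0 * U i) = U := by
    rw [oneParam_zero hXc, one_mul, Function.update_eq_self]
  simp only [h0] at h
  refine (h.congr_deriv ?_).congr_of_eventuallyEq (Eventually.of_forall fun t => rfl)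
  simp only [adjDir_apply]
  noncomm_ring

end Conj

/-! ## The main theorem: left rows ⇒ right rows -/

section Main

variable {K : Type*} {k : K → ℝ → G} {X : K → Matrix (Fin r.N) (Fin r.N) ℂ} {J : Type*} [Fintype J]
  (dir : J → K) (coef : J → (Matrix (Fin r.N) (Fin r.N) ℂ →ₗ[ℝ] ℝ))

/-- **Linear coordinates of matrix polynomials are polynomial** — the hypothesis shape `hcoef` of the
main theorem, recorded as a definition for readability: a linear functional `c` of matrices turns
every matrix-valued polynomial observable into a polynomial observable. [shape] A parametric
definition of a proposition — NOT a fact. [folklore] -/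
def PreservesPoly (c : Matrix (Fin r.N) (Fin r.N) ℂ →ₗ[ℝ] ℝ) : Prop :=
  ∀ M : (ι → G) → Matrix (Fin r.N) (Fin r.N) ℂ, EntriesPoly r M → (fun U => c (M U)) ∈ polyFunctions (ι := ι) r

/-- The real part of a fixed entry preserves polynomiality. -/
theorem preservesPoly_re_entry (a b : Fin r.N) (s : ℝ) :
    PreservesPoly (ι := ι) r (s • (Complex.reLm ∘ₗ (Matrix.entryLinearMap ℂ ℂ a b).restrictScalars ℝ)) := by
  intro M hM
  have h : (fun U => (s • (Complex.reLm ∘ₗ (Matrix.entryLinearMap ℂ ℂ a b).restrictScalars ℝ)) (M U)) =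
      s • fun U => (M U a b).re := by
    funext U; simp
  rw [h]
  exact Subalgebra.smul_mem _ (hM a b).1 s

/-- The imaginary part of a fixed entry preserves polynomiality. -/
theorem preservesPoly_im_entry (a b : Fin r.N) (s : ℝ) :
    PreservesPoly (ι := ι) r (s • (Complex.imLm ∘ₗ (Matrix.entryLinearMap ℂ ℂ a b).restrictScalars ℝ)) := by
  intro M hM
  have h : (fun U => (s • (Complex.imLm ∘ₗ (Matrix.entryLinearMap ℂ ℂ a b).restrictScalars ℝ)) (M U)) =
      s • fun U => (M U a b).im := by
    funext U; simp
  rw [h]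
  exact Subalgebra.smul_mem _ (hM a b).2 s

variable [ContinuousMul G] [DecidableEq ι]

/-- ★★★ **Left loop equations imply right loop equations.** Let `ρ(k_a t) = e^{tX_a}` be exponential
one-parameter families of the faithful unitary representation `r`, and suppose finitely many of
their generators `X_{dir j}` with linear coordinates `coef j` REPRODUCE every conjugated generator,
`Y = Σ_j coef_j(Y) X_{dir j}` for `Y = ρ(g) X_a ρ(g⁻¹)` (`hrep`), with DIVERGENCE-FREE coordinates
`coef_j([X_{dir j}, Y]) = 0` (`hdiv`) which map matrix polynomials to polynomials (`hcoef`). Then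
every Schwinger–Dyson functional for polynomial local actions `S i` (left rows, all links, all
`a`, all polynomial test functions) satisfies the RIGHT rows. No positivity, no normalisation.
[folklore] -/
theorem IsSDFunctional.isRightSDFunctional (hk : ∀ a s t, k a (s + t) = k a s * k a t)
    (hX : ∀ a t, r.ρ (k a t) = exp ((t : ℂ) • X a))
    (hrep : ∀ (a : K) (g : G),
      r.ρ g * X a * r.ρ g⁻¹ = ∑ j, coef j (r.ρ g * X a * r.ρ g⁻¹) • X (dir j))
    (hdiv : ∀ (j : J) (a : K) (g : G),
      coef j (X (dir j) * (r.ρ g * X a * r.ρ g⁻¹) - (r.ρ g * X a * r.ρ g⁻¹) * X (dir j)) = 0)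
    (hcoef : ∀ j, PreservesPoly (ι := ι) r (coef j))
    {S : ι → (ι → G) → ℝ} (hS : ∀ i, S i ∈ polyFunctions (ι := ι) r) {β : ℝ}
    {φ : C(ι → G, ℝ) →ₗ[ℝ] ℝ} (hφ : IsSDFunctional r k S β φ) : IsRightSDFunctional r k S β φ := by
  intro i a
  -- the left data along the finitely many directions `dir j`
  choose Sd hSdm hSd hrow using fun j => hφ i (dir j)
  -- the coordinate observables `cf j (U) = coef j (Y U)`, `Y U = ρ(U_i) X_a ρ(U_i⁻¹)`
  have hcfex : ∀ j, ∃ g ∈ polyAlgebra (ι := ι) r, ⇑g = fun U => coef j (adjDir r i (X a) U) := fun j =>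
    (mem_polyFunctions_iff r).1 (hcoef j _ (entriesPoly_adjDir r i (X a)))
  choose cf hcfm hcfe using hcfex
  have hcf : ∀ j U, cf j U = coef j (adjDir r i (X a) U) := fun j U => congrFun (hcfe j) U
  -- their left derivatives along `dir j`: polynomial, with value `coef j [X_{dir j}, Y]`
  choose cfd hcfdm hcfd using fun j => exists_deriv_mem_polyAlgebra r (hk (dir j)) (hX (dir j)) i (hcfm j)
  have hcfd_val : ∀ j U, cfd j U =
      coef j (X (dir j) * adjDir r i (X a) U - adjDir r i (X a) U * X (dir j)) := fun j U => by
    have h1 := hcfd j U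
    have h2 : HasDerivAt (fun t => cf j (Function.update U i (k (dir j) t * U i)))
        (coef j (X (dir j) * adjDir r i (X a) U - adjDir r i (X a) U * X (dir j))) 0 := by
      have h := (LinearMap.toContinuousLinearMap (coef j)).hasFDerivAt.comp_hasDerivAt 0
        (hasDerivAt_adjDir_update r i (X a) (hk (dir j)) (hX (dir j)) U)
      refine h.congr_of_eventuallyEq (Eventually.of_forall fun t => ?_)
      simp only [Function.comp_apply, LinearMap.coe_toContinuousLinearMap', hcf]
    exact h1.unique h2
  -- the divergence vanishes identically
  have hdiv0 : ∑ j, cfd j = 0 := by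
    ext U
    rw [ContinuousMap.coe_sum, Finset.sum_apply, ContinuousMap.zero_apply]
    exact Finset.sum_eq_zero fun j _ => by rw [hcfd_val, adjDir_apply, hdiv j a (U i)]
  -- the right derivative of the action
  set SR : C(ι → G, ℝ) := ∑ j, cf j * Sd j with hSR
  have hSRm : SR ∈ polyAlgebra (ι := ι) r :=
    Subalgebra.sum_mem _ fun j _ => Subalgebra.mul_mem _ (hcfm j) (hSdm j)
  -- linear left derivative of a function with polynomial left derivatives `fd j` along `dir j`
  -- evaluated at `Y U` is `Σ_j cf j U * fd j U`
  have key : ∀ {F : (ι → G) → ℝ} {D : (ι → G) → Matrix (Fin r.N) (Fin r.N) ℂ →ₗ[ℝ] ℝ},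
      HasLinearShiftDeriv r i F D → ∀ (fd : J → C(ι → G, ℝ)),
      (∀ j U, HasDerivAt (fun t => F (Function.update U i (k (dir j) t * U i))) (fd j U) 0) →
      ∀ U, D U (adjDir r i (X a) U) = (∑ j, cf j * fd j) U := by
    intro F D hD fd hfd U
    rw [adjDir_apply, hrep a (U i), map_sum, ContinuousMap.coe_sum, Finset.sum_apply]
    refine Finset.sum_congr rfl fun j _ => ?_
    rw [map_smul, smul_eq_mul, ContinuousMap.mul_apply, hcf, adjDir_apply,
      hD.eq_of_hasDerivAt (hX (dir j)) (hfd j U)]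
  refine ⟨SR, hSRm, fun U => ?_, fun f hf f' hf'm hf' => ?_⟩
  · -- derivative of `S i` along the right shift
    obtain ⟨DS, hDS⟩ := exists_hasLinearShiftDeriv_of_mem_polyFunctions r i (hS i)
    have h := hDS.hasDerivAt_rightShift (hX a) U
    rwa [show r.ρ (U i) * X a * r.ρ (U i)⁻¹ = adjDir r i (X a) U from rfl, key hDS Sd hSd U] at h
  · -- the right row for `f`
    obtain ⟨Df, hDf⟩ := exists_hasLinearShiftDeriv_of_mem_polyAlgebra r i hf
    choose fd hfdm hfd using fun j => exists_deriv_mem_polyAlgebra r (hk (dir j)) (hX (dir j)) i hf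
    have hf'eq : f' = ∑ j, cf j * fd j := by
      ext U
      rw [← key hDf fd hfd U]
      exact (hf' U).unique (hDf.hasDerivAt_rightShift (hX a) U)
    -- Leibniz + the left row along `dir j` for the test function `cf j * f`
    have hrowj : ∀ j, φ (cf j * fd j) = β * φ (cf j * f * Sd j) - φ (cfd j * f) := fun j => by
      have hderiv : ∀ U, HasDerivAt (fun t => (cf j * f) (Function.update U i (k (dir j) t * U i)))
          ((cfd j * f + cf j * fd j) U) 0 := fun U => by
        have h0 : Function.update U i (k (dir j) 0 * U i) = U := by
          rw [oneParam_zero (hX (dir j)), one_mul, Function.update_eq_self]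
        have h := (hcfd j U).mul (hfd j U)
        simp only [h0] at h
        exact h.congr_of_eventuallyEq (Eventually.of_forall fun t => rfl)
      have h := hrow j (cf j * f) (Subalgebra.mul_mem _ (hcfm j) hf) (cfd j * f + cf j * fd j)
        (Subalgebra.add_mem _ (Subalgebra.mul_mem _ (hcfdm j) hf) (Subalgebra.mul_mem _ (hcfm j) (hfdm j)))
        hderiv
      rw [map_add] at h
      linarith
    have hsum1 : ∑ j, cf j * f * Sd j = f * SR := by
      rw [hSR, Finset.mul_sum]
      exact Finset.sum_congr rfl fun j _ => by ring
    have hsum2 : ∑ j, cfd j * f = (∑ j, cfd j) * f := by rw [Finset.sum_mul]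
    calc φ f' = ∑ j, φ (cf j * fd j) := by rw [hf'eq, map_sum]
      _ = β * φ (∑ j, cf j * f * Sd j) - φ (∑ j, cfd j * f) := by
          simp only [hrowj, Finset.sum_sub_distrib, map_sum, Finset.mul_sum]
      _ = β * φ (f * SR) := by rw [hsum1, hsum2, hdiv0, zero_mul, map_zero, sub_zero]

end Main

end Summit.QuantumFields.GaugeBoot

end
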